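import Literature.Analysis.UnboundedOperators.LumerPhillipsQuasi
import Literature.Analysis.UnboundedOperators.SemigroupDuhamel
import Literature.Analysis.UnboundedOperators.SemigroupNumericalRangeGrowth
import HarnessLib

/-!
# The generation theorem for quasi-contractive semigroups, both directions (Engel–Nagel II Thm. 3.15 /
  Cor. 3.6): `A` generates a C₀-semigroup with `‖T(t)‖ ≤ e^{ωt}` iff `A` is densely defined, quasi-dissipative
  and satisfies the range condition — and that semigroup is unique

Analysis/UnboundedOperators proofs-layer file (theorems only, no definitions, no named facts).
`LumerPhillipsQuasi.lean` proves the generation direction (`IsQuasiDissipativeData A ω ⇒ ∃ T`). This file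
proves the CONVERSE from the tree's Laplace-transform theory of the resolvent (`R(λ) = ∫₀^∞ e^{−λt}T(t)dt`,
`‖R(λ)‖ ≤ 1/(λ − ω)`, `(λ − A)R(λ) = 1`, `R(λ)(λ − A) = 1_{D(A)}` — `SemigroupLaplaceResolventGenerator.lean`)
and the density of `D(A)` (`StrongContRepresentationDensityProofs.lean`):

* `C0Semigroup.quasiDissipative_generator` — `‖T(t)‖ ≤ e^{ωt}` ⇒ `(λ − ω)‖x‖ ≤ ‖λx − Ax‖` (`λ > ω`);
* `C0Semigroup.surj_sub_generator` — `λ − A` is onto for `λ > ω`;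
* `C0Semigroup.isQuasiDissipativeData_generator`, `C0Semigroup.isLumerPhillipsData_generator`;
* **`isQuasiDissipativeData_iff`**, **`isLumerPhillipsData_iff`** — the characterisations;
* `IsQuasiDissipativeData.existsUnique_c0Semigroup` — uniqueness (`C0Semigroup.eq_of_generator_eq`), and
  `IsQuasiDissipativeData.norm_app_le_of_generator_eq` — ANY C₀-semigroup whose generator is `ω`-quasi-dissipative
  obeys `‖T(t)‖ ≤ e^{ωt}` (growth bound from the numerical range).

## References

* K.-J. Engel, R. Nagel, *One-Parameter Semigroups for Linear Evolution Equations* (2000), Ch. II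
  Thm. 1.4, Thm. 1.10, Cor. 3.6, Thm. 3.15. [EngelNagel2000]
-/

noncomputable section

open MeasureTheory Set Filter Literature.Analysis.OperatorTheory
open scoped Topology NNReal

namespace Literature.Analysis.UnboundedOperators

variable {E : Type*} [NormedAddCommGroup E] [NormedSpace ℂ E] [CompleteSpace E]

namespace C0Semigroup

omit [CompleteSpace E] in
/-- `∫₀^∞ e^{(ω − λ)t} dt = 1/(λ − ω)` for `λ > ω` (with the factor `M = 1`). [folklore] -/
private theorem one_mul_integral_exp_eq {ω l : ℝ} (hl : ω < l) :
    (1 * ∫ t in Ioi (0 : ℝ), Real.exp ((ω - l) * t)) = (l - ω)⁻¹ := by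
  rw [one_mul, integral_exp_mul_Ioi (by linarith) 0, mul_zero, Real.exp_zero, neg_div, ← div_neg, neg_sub, one_div]

/-- **The generator of a quasi-contractive semigroup is quasi-dissipative**: `‖T(t)‖ ≤ e^{ωt}` implies
`(λ − ω)‖x‖ ≤ ‖λx − Ax‖` for real `λ > ω` and `x ∈ D(A)` (from `x = R(λ)(λ − A)x` and `‖R(λ)‖ ≤ 1/(λ − ω)`).
[cite: EngelNagel2000, Ch. II Cor. 3.6] -/
theorem quasiDissipative_generator (T : C0Semigroup ℂ E) {ω : ℝ} (hT : ∀ t : ℝ≥0, ‖T.app t‖ ≤ Real.exp (ω * t))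
    {l : ℝ} (hl : ω < l) (x : T.generator.domain) :
    (l - ω) * ‖(x : E)‖ ≤ ‖(l : ℂ) • (x : E) - T.generator x‖ := by
  have hM : ∀ t : ℝ≥0, ‖T.app t‖ ≤ 1 * Real.exp (ω * t) := fun t => by rw [one_mul]; exact hT t
  have hl' : ω < (l : ℂ).re := by simpa using hl
  have h2 := norm_laplaceResolventFun_le T hM hl' ((l : ℂ) • (x : E) - T.generator x)
  rw [laplaceResolventFun_sub_generator T hM hl' x, Complex.ofReal_re, one_mul_integral_exp_eq hl] at h2
  have hlω : 0 < l - ω := sub_pos.2 hl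
  calc (l - ω) * ‖(x : E)‖ ≤ (l - ω) * ((l - ω)⁻¹ * ‖(l : ℂ) • (x : E) - T.generator x‖) :=
        mul_le_mul_of_nonneg_left h2 hlω.le
    _ = ‖(l : ℂ) • (x : E) - T.generator x‖ := by field_simp

/-- **Range condition for a generator**: `λ − A` is onto for real `λ > ω` (`x = R(λ)y` solves `λx − Ax = y`).
[cite: EngelNagel2000, Ch. II Thm. 1.10] -/
theorem surj_sub_generator (T : C0Semigroup ℂ E) {ω : ℝ} (hT : ∀ t : ℝ≥0, ‖T.app t‖ ≤ Real.exp (ω * t))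
    {l : ℝ} (hl : ω < l) (y : E) :
    ∃ x : T.generator.domain, (l : ℂ) • (x : E) - T.generator x = y := by
  have hM : ∀ t : ℝ≥0, ‖T.app t‖ ≤ 1 * Real.exp (ω * t) := fun t => by rw [one_mul]; exact hT t
  have hl' : ω < (l : ℂ).re := by simpa using hl
  refine ⟨⟨T.laplaceResolventFun l y, laplaceResolventFun_mem_generator_domain T hM hl' y⟩, ?_⟩
  rw [generator_laplaceResolventFun T hM hl' y]
  exact sub_sub_cancel _ _

/-- **Converse of Lumer–Phillips with growth bound**: the generator of a C₀-semigroup with `‖T(t)‖ ≤ e^{ωt}` is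
densely defined, `ω`-quasi-dissipative and satisfies the range condition. [cite: EngelNagel2000, Ch. II Cor. 3.6] -/
theorem isQuasiDissipativeData_generator (T : C0Semigroup ℂ E) {ω : ℝ} (hT : ∀ t : ℝ≥0, ‖T.app t‖ ≤ Real.exp (ω * t)) :
    HilleYosida.IsQuasiDissipativeData T.generator ω where
  dense := T.dense_generator_domain_of_normedSpace_real
  dissipative _ hl x := T.quasiDissipative_generator hT hl x
  surj _ hl y := T.surj_sub_generator hT hl y

/-- **Converse of Lumer–Phillips**: the generator of a contraction C₀-semigroup is m-dissipative (dense domain,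
`λ‖x‖ ≤ ‖λx − Ax‖`, `λ − A` onto, `λ > 0`). [cite: EngelNagel2000, Ch. II Thm. 3.15] -/
theorem isLumerPhillipsData_generator (T : C0Semigroup ℂ E) (hT : T.IsContraction) :
    HilleYosida.IsLumerPhillipsData T.generator := by
  have h := T.isQuasiDissipativeData_generator (ω := 0) (fun t => by simpa using hT t)
  exact { dense := h.dense, dissipative := fun l hl x => by simpa using h.dissipative l hl x, surj := h.surj }

end C0Semigroup

namespace HilleYosida

/-- **GENERATION THEOREM FOR QUASI-CONTRACTIVE SEMIGROUPS (Engel–Nagel II Cor. 3.6 / Thm. 3.15).** `A` is the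
generator of a C₀-semigroup with `‖T(t)‖ ≤ e^{ωt}` if and only if `A` is densely defined with
`(λ − ω)‖x‖ ≤ ‖λx − Ax‖` and `λ − A` onto for all real `λ > ω`. [cite: EngelNagel2000, Ch. II Thm. 3.15] -/
theorem isQuasiDissipativeData_iff (A : E →ₗ.[ℂ] E) (ω : ℝ) :
    IsQuasiDissipativeData A ω ↔ ∃ T : C0Semigroup ℂ E, (∀ t : ℝ≥0, ‖T.app t‖ ≤ Real.exp (ω * t)) ∧ T.generator = A := by
  constructor
  · intro h
    obtain ⟨T, hT, -, hgen⟩ := h.exists_c0Semigroup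
    exact ⟨T, hT, hgen⟩
  · rintro ⟨T, hT, rfl⟩
    exact T.isQuasiDissipativeData_generator hT

/-- **LUMER–PHILLIPS, BOTH DIRECTIONS (Engel–Nagel II Thm. 3.15).** `A` generates a contraction C₀-semigroup iff
`A` is densely defined, dissipative and `λ − A` is onto for `λ > 0`. [cite: EngelNagel2000, Ch. II Thm. 3.15] -/
theorem isLumerPhillipsData_iff (A : E →ₗ.[ℂ] E) :
    IsLumerPhillipsData A ↔ ∃ T : C0Semigroup ℂ E, T.IsContraction ∧ T.generator = A := by
  constructor
  · intro h
    obtain ⟨T, hT, -, hgen⟩ := h.exists_c0Semigroup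
    exact ⟨T, hT, hgen⟩
  · rintro ⟨T, hT, rfl⟩
    exact T.isLumerPhillipsData_generator hT

/-- **Uniqueness**: an `ω`-quasi-dissipative operator with the range condition is the generator of EXACTLY ONE
C₀-semigroup. [cite: EngelNagel2000, Ch. II Thm. 1.4] -/
theorem IsQuasiDissipativeData.existsUnique_c0Semigroup {A : E →ₗ.[ℂ] E} {ω : ℝ} (h : IsQuasiDissipativeData A ω) :
    ∃! T : C0Semigroup ℂ E, T.generator = A := by
  obtain ⟨T, -, -, hgen⟩ := h.exists_c0Semigroup
  exact ⟨T, hgen, fun S hS => C0Semigroup.eq_of_generator_eq S T (hS.trans hgen.symm)⟩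

/-- **Growth bound from the numerical range / dissipativity, for ANY semigroup with that generator**: if
`T.generator` is `ω`-quasi-dissipative with the range condition then `‖T(t)‖ ≤ e^{ωt}` (uniqueness + the
Lumer–Phillips semigroup). [cite: EngelNagel2000, Ch. II Cor. 3.6] -/
theorem IsQuasiDissipativeData.norm_app_le_of_generator_eq {A : E →ₗ.[ℂ] E} {ω : ℝ} (h : IsQuasiDissipativeData A ω)
    (T : C0Semigroup ℂ E) (hT : T.generator = A) (t : ℝ≥0) : ‖T.app t‖ ≤ Real.exp (ω * t) := by
  obtain ⟨S, hS, -, hgen⟩ := h.exists_c0Semigroup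
  rw [C0Semigroup.eq_of_generator_eq T S (hT.trans hgen.symm)]
  exact hS t

/-- The contraction case: if `T.generator` is m-dissipative then `T` is a contraction semigroup.
[cite: EngelNagel2000, Ch. II Thm. 3.15] -/
theorem IsLumerPhillipsData.isContraction_of_generator_eq {A : E →ₗ.[ℂ] E} (h : IsLumerPhillipsData A)
    (T : C0Semigroup ℂ E) (hT : T.generator = A) : T.IsContraction := fun t => by
  simpa using h.isQuasiDissipativeData.norm_app_le_of_generator_eq T hT t

/-! ### Hilbert space: the range condition is automatic for a generator with a numerical-range bound -/

/-- **Hilbert-space converse via the numerical range**: if the generator of a C₀-semigroup on a complex Hilbert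
space satisfies `Re⟪Ax, x⟫ ≤ ω‖x‖²` on `D(A)`, then `A` is `ω`-quasi-dissipative WITH the range condition
(`‖T(t)‖ ≤ e^{ωt}` by the energy method `C0Semigroup.norm_app_le_of_re_inner_le`, then
`C0Semigroup.isQuasiDissipativeData_generator`). [cite: EngelNagel2000, Ch. II Cor. 3.6] -/
theorem isQuasiDissipativeData_generator_of_re_inner_le {H : Type*} [NormedAddCommGroup H] [InnerProductSpace ℂ H]
    [CompleteSpace H] (T : C0Semigroup ℂ H) {ω : ℝ}
    (hre : ∀ x : T.generator.domain, (inner ℂ (T.generator x : H) (x : H)).re ≤ ω * ‖(x : H)‖ ^ 2) :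
    IsQuasiDissipativeData T.generator ω :=
  T.isQuasiDissipativeData_generator (T.norm_app_le_of_re_inner_le hre)

/-- The dissipative Hilbert case: `Re⟪Ax, x⟫ ≤ 0` on `D(A)` for a generator ⇒ `A` is m-dissipative
(`IsLumerPhillipsData`). [cite: EngelNagel2000, Ch. II Thm. 3.15] -/
theorem isLumerPhillipsData_generator_of_re_inner_nonpos {H : Type*} [NormedAddCommGroup H] [InnerProductSpace ℂ H]
    [CompleteSpace H] (T : C0Semigroup ℂ H)
    (hre : ∀ x : T.generator.domain, (inner ℂ (T.generator x : H) (x : H)).re ≤ 0) :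
    IsLumerPhillipsData T.generator :=
  T.isLumerPhillipsData_generator (T.isContraction_of_re_inner_nonpos hre)

end HilleYosida

end Literature.Analysis.UnboundedOperators
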